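import Summits.QuantumFields.BalabanUV.Beta.GAN24.DirichletVertexDomSum
import Summits.QuantumFields.BalabanUV.Beta.GAN24.DirichletVertexFlux
import Summits.QuantumFields.BalabanUV.Beta.GAN24.DirichletVertexEnergyField
import Summits.QuantumFields.BalabanUV.Beta.GAN24.DirichletVertexRefine
import Summits.QuantumFields.BalabanUV.Beta.GAN24.DirichletBoxWeightedSockets

/-!
# `BalabanUV.Beta.GAN24.DirichletVertexEnd` — binder row G-an2-4 / (CONV-C), road P2 PART IV, leaf L14 (the torus transfer), THE END:
# THE TWO-LEVEL INJECTED LAW OF THE Ω-COMPRESSED `U = 1` SCALAR FREE TOWER ON EVERY UNION OF UNIT BLOCKS IN `d = 2`, WITH THE FULL RATE `1/N`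
# (unit b2b-balaban-gan24-p2, gen 27, v1)

HONEST FRAMING (cell contract, verbatim): «discharging `BetaPertH` makes Bałaban's UV stability UNCONDITIONAL — a real constructive-QFT
result; it is NOT the continuum limit and NOT the Clay problem.»  SUPPLIER module under the T⁴-DAG sub-row `T4-U1a.S-NE2-D1-DIRICHLET°`
(holder: the t4-ne2-p1 lineage; owner wording R24 «the full rate L⁻¹ beyond boxes OPEN»).  The weighted socket
`DirichletBoxWeightedSockets.injected_le_of_weighted` (p234489, gen 24) gives `‖(D′^{Ω′})⁻¹J^Ω − J^Ω(D^Ω)⁻¹‖ ≤ (2/N)(√α′√β + √φ′√φ)` from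
four displayed one-level binders (A′), (B), (Φ′), (Φ) and the weight comparison `hcomp`.  THIS FILE DISCHARGES ALL OF THEM for `d = 2`,
`Ω = blockReg N M S` ANY set `S` of unit blocks of the coarse torus `Tor (fine N M)` (`M_ν ≥ 2` blocks, `N ≥ 64` sites per block side),
`Ω′ = par⁻¹Ω` on `Tor (fine (R·N) M)`, with the weights `ω := ω_V` (p244737, `V` = all re-entrant vertices) and `w′ := wfine` (p245204):
(B) p247094 (= p244737 re-packaged); `hcomp` p245204; (A′) = the dominated Hessian `DirichletVertexDomSum.dom_sum_solExt` (p247015) at level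
`RN` with `g = wfine` (`wfine_emb_le`); (Φ), (Φ′) = `DirichletVertexFlux` (p246955) + (B) + the dominated Hessian with `g = ω_V`.  RESULT:
`‖(D′^{Ω′})⁻¹J^Ω − J^Ω(D^Ω)⁻¹‖ ≤ C(a′, ε, |V|, |Tor M|, R)/N` — the FULL RATE `1/N` on every union of unit blocks in two dimensions
(`injected_le_union`, `injected_rate_union`).  Along the tower `N = L^k`, `R = L` this is the scalar-carrier `hinj` shape with
`e₁(k) = C·L^{−k}`, now beyond boxes.

## Contents ([folklore] assembly; 0 sorry)
* §1 the four binders: `binderA` (A′), `binderB` (B), `binderE` (Φ′), `binderT` (Φ); §2 **`injected_le_union`**, **`injected_rate_union`**.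

ABSOLUTE RULE (cell, verbatim): «No internally-minted statement may enter as a cited fact. Every hypothesis is either kernel-proved in
this package or a verbatim quotation of a PUBLISHED theorem with page reference. The manuscript(s) under audit are NOT citable for
their own disputed steps — they are the thing under adjudication; programme-internal (2001/route/tribunal) claims are never citable.»
Nothing printed is a hypothesis; all inputs are kernel theorems of this package on the tree's typed `U = 1` objects
([Balaban1985BackgroundPropagators] (3.24) p. 394 at `U = 1` is the DEFINITION of `Δ′`, not a hypothesis).  HONEST: `U = 1` SCALAR layer,
`d = 2` only; constants carry `|V|`, `|Tor M|` (volume-dependent — a window-overlap count would remove this; NOT done) and `10⁹/(γ−1)`,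
`128⁴`; `N ≥ 64`; NOT the vector layer `calDalev`, NOT `d = 3, 4`, NOT NE2, NOT (CONV-C) as a whole, NEVER «G-an2-4 closed»; NOT D1 ∕
BetaPertH ∕ continuum ∕ Clay.  «not in print; our proof attempt».  HONEST DEPENDENCY: continuum YM on T⁴ ⇐ BetaPertH ∧ nine spine
estimates (0/9 proved); BetaPertH ⇐ (D1) ∧ (D4) ∧ CAP+tail; G-an2-4 gates asym, D1 and NE2/3/4.
-/

noncomputable section

open scoped BigOperators ComplexConjugate Matrix Matrix.Norms.L2Operator
open Finset

namespace Summit.QuantumFields.BalabanUV.Beta.GAN24.DirichletVertexEnd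

open Literature.MathematicalPhysics.QuantumFieldTheory.Balaban1983to89.B5Prop11Plancherel (Tor fine unitVec)
open Literature.MathematicalPhysics.QuantumFieldTheory.Balaban1983to89.B5Action121 (sdiff LapS)
open Literature.MathematicalPhysics.QuantumFieldTheory.Balaban1983to89.B5Prop11Lower (nsq nsq_nonneg)
open Summit.QuantumFields.BalabanUV.T4Continuum.ScalarAveragedPropagator (gammaPs gammaPs_pos)
open Summit.QuantumFields.BalabanUV.Beta.GAN24.DirichletBoxRegularity (Pdir)
open Summit.QuantumFields.BalabanUV.Beta.GAN24.DirichletBoxTrace (blockReg)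
open Summit.QuantumFields.BalabanUV.Beta.GAN24.DirichletBoxCompression (DOm JOm solExt refineR solExt_apply_of_not)
open Summit.QuantumFields.BalabanUV.Beta.GAN24.DirichletBoxTwoLevelCore (bdryPart refineR_blockReg_iff)
open Summit.QuantumFields.BalabanUV.Beta.GAN24.DirichletBoxWeightedSockets (injected_le_of_weighted)
open DirichletRingCutoff (tIdx one_le_tIdx)
open DirichletRingHessianWindow (rho)
open DirichletVertexChart
open DirichletVertexEnergy (omegaV omegaV_pos omegaV_le_one betaV one_le_rho)
open DirichletVertexHessian (alphaV)
open DirichletVertexRefine (wfine wfine_nonneg wfine_le_three wfine_emb_le wfine_hcomp omegaV_emb_le)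
open DirichletVertexDomSum (alphaDom dom_sum_solExt)
open DirichletVertexFlux (bdry_sum_le exterior_sum_le)
open DirichletVertexEnergyField (Vre Vre_sound Vre_complete exists_J weighted_energy_solExt_le')

variable (N R : ℕ) [NeZero N] [NeZero R] (M : Fin 2 → ℕ) [hM : ∀ μ, NeZero (M μ)] (S : Tor M → Prop) [DecidablePred S] (a' : ℝ)

/-! ## §1 The four binders of the weighted socket on a union of unit blocks -/

omit [NeZero N] in
/-- the window bound `ρ ≤ 2^{J+3} ⟹ tIdx ≤ R·(N−2)` and `≤ n − 1` from the dyadic condition `20·2^J + 1 ≤ n − 1` (`n = R·N`, `N ≥ 4`). [folklore] -/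
theorem dyadic_window {J : ℕ} (hJ : 20 * 2 ^ J + 1 ≤ R * N - 1) (hN : 4 ≤ N) {i j : ℤ} (hρ : rho i j ≤ 2 ^ (J + 3)) :
    tIdx i ≤ (R : ℤ) * ((N - 1 - 1 : ℕ) : ℤ) ∧ tIdx j ≤ (R : ℤ) * ((N - 1 - 1 : ℕ) : ℤ)
      ∧ tIdx i ≤ ((R * N - 1 : ℕ) : ℤ) ∧ tIdx j ≤ ((R * N - 1 : ℕ) : ℤ) := by
  have hR1 : 1 ≤ R := Nat.pos_of_ne_zero (NeZero.ne R)
  set X : ℕ := R * N with hX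
  have hX4 : 4 * R ≤ X := by rw [hX, mul_comm]; exact Nat.mul_le_mul_left R hN
  have h20 : 20 * 2 ^ J + 2 ≤ X := by omega
  have hi : tIdx i ≤ rho i j := le_max_left _ _
  have hj : tIdx j ≤ rho i j := le_max_right _ _
  have h8 : (2 : ℤ) ^ (J + 3) = 8 * 2 ^ J := by ring
  have hP : ((2 ^ J : ℕ) : ℤ) = (2 : ℤ) ^ J := by push_cast; ring
  have hN2 : ((N - 1 - 1 : ℕ) : ℤ) = (N : ℤ) - 2 := by omega
  have hX1 : ((R * N - 1 : ℕ) : ℤ) = (X : ℤ) - 1 := by omega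
  have hXZ : (X : ℤ) = (R : ℤ) * N := by rw [hX]; push_cast; ring
  have h20' : (20 : ℤ) * 2 ^ J + 2 ≤ X := by rw [← hP]; exact_mod_cast h20
  have hX4' : (4 : ℤ) * R ≤ X := by exact_mod_cast hX4
  rw [hN2, hX1]
  refine ⟨?_, ?_, ?_, ?_⟩ <;> nlinarith

section Binders

variable {ε : ℝ}

/-- **(A′): THE WEIGHTED INTERIOR HESSIAN OF THE FINE SOLUTION** with the socket's fine weight `w′ = wfine`:
`Σ_μ Σ_{x∈Ω′} w′(x)|(∂′ᴴ_μ∂′_μ v_w)(x)|² ≤ α_dom(|V|, |Tor M|, 3(1+2R), 3)·‖w‖²` (`N ≥ 64`, `M_ν ≥ 2`). [folklore] -/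
theorem binderA (hN : 64 ≤ N) (hM2 : ∀ ν, 2 ≤ M ν) (ha' : 0 < a') (hε : 0 < ε) (hγ : 1 < Real.pi / 3 * (1 - ε / 2))
    (w : {x // refineR N R M (blockReg N M S) x} → ℂ) :
    ∑ μ, ∑ x ∈ univ.filter (refineR N R M (blockReg N M S)),
        wfine N R M (Vre M S) (N - 1) x
          * ‖(Pdir (fine (R * N) M) ((R * N : ℕ) : ℂ) μ *ᵥ solExt (R * N) M a' (refineR N R M (blockReg N M S)) w) x‖ ^ 2
      ≤ alphaDom (Vre M S).card (Fintype.card (Tor M)) (3 * (1 + 2 * R)) 3 ε a' * nsq w := by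
  have hR1 : 1 ≤ R := Nat.pos_of_ne_zero (NeZero.ne R)
  have hRN : 64 ≤ R * N := le_trans hN (Nat.le_mul_of_pos_left N hR1)
  obtain ⟨J, hJ1, hJ2⟩ := exists_J (R * N) hRN
  have hR0 : (0 : ℝ) < R := by exact_mod_cast hR1
  have hN0 : (0 : ℝ) < N := by exact_mod_cast Nat.pos_of_ne_zero (NeZero.ne N)
  refine dom_sum_solExt (R * N) M S a' hRN hM2 (Vre M S) (Vre_sound M S) (Vre_complete M S) hJ2 hJ1 hε hγ ha'
    (g := wfine N R M (Vre M S) (N - 1)) (Cg := 3 * (1 + 2 * R)) (gmax := 3) (by positivity) (wfine_nonneg N R M _ _)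
    (wfine_le_three N R M _ _) (fun σ b hv i j _ hρ => ?_) (refineR N R M (blockReg N M S)) (refineR_blockReg_iff N R M S) w
  obtain ⟨hi, hj, -, -⟩ := dyadic_window N R hJ1 (by omega) hρ
  have h := wfine_emb_le N R M (V := Vre M S) hv (K := N - 1) (by omega) hi hj
  refine h.trans ?_
  have hρ1 : (1 : ℝ) ≤ (rho i j : ℝ) := by exact_mod_cast one_le_rho i j
  have e : ((R * N : ℕ) : ℝ) = (R : ℝ) * N := by push_cast; ring
  rw [e, div_le_div_iff_of_pos_right (by positivity)]
  nlinarith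

/-- **(B): THE INVERSE-WEIGHTED ENERGY OF THE COARSE SOLUTION**: `Σ_μ Σ_y ω_V(y)⁻¹|(∂_μ u_f)(y)|² ≤ β_V·‖f‖²`. [folklore] -/
theorem binderB (hN : 2 ≤ N) (hM2 : ∀ ν, 2 ≤ M ν) (ha' : 0 < a') (hε : 0 < ε) (hγ : 1 < Real.pi / 3 * (1 - ε / 2))
    (f : {y // blockReg N M S y} → ℂ) :
    ∑ μ, ∑ y, (omegaV N M (Vre M S) (N - 1) y)⁻¹ * ‖(sdiff (fine N M) (N : ℂ) μ *ᵥ solExt N M a' (blockReg N M S) f) y‖ ^ 2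
      ≤ betaV (Vre M S).card ε a' * nsq f :=
  weighted_energy_solExt_le' N M S a' (Vre M S) (Vre_sound M S) hN (hM2 0) (hM2 1) ha' hε hγ (blockReg N M S) (fun _ => Iff.rfl) f

/-- the flux constant `X = 18·β_V + (1+|V|)·α_dom(|V|, |Tor M|, 1, 1)`. [folklore] -/
def Xflux (cardV cardT : ℕ) (ε a' : ℝ) : ℝ := 18 * betaV cardV ε a' + (1 + cardV) * alphaDom cardV cardT 1 1 ε a'

/-- the dominated Hessian with `g = ω_V` at any level `n ≥ 64`, for any decidable spelling of the block region. [folklore] -/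
theorem hessian_omega_le (n : ℕ) [NeZero n] (hn : 64 ≤ n) (hM2 : ∀ ν, 2 ≤ M ν) (ha' : 0 < a') (hε : 0 < ε)
    (hγ : 1 < Real.pi / 3 * (1 - ε / 2)) (p : Tor (fine n M) → Prop) [DecidablePred p] (hp : ∀ x, p x ↔ blockReg n M S x)
    (f : {x // p x} → ℂ) :
    ∑ μ, ∑ x ∈ univ.filter p, omegaV n M (Vre M S) (n - 1) x * ‖(Pdir (fine n M) (n : ℂ) μ *ᵥ solExt n M a' p f) x‖ ^ 2
      ≤ alphaDom (Vre M S).card (Fintype.card (Tor M)) 1 1 ε a' * nsq f := by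
  obtain ⟨J, hJ1, hJ2⟩ := exists_J n hn
  refine dom_sum_solExt n M S a' hn hM2 (Vre M S) (Vre_sound M S) (Vre_complete M S) hJ2 hJ1 hε hγ ha'
    (g := omegaV n M (Vre M S) (n - 1)) (Cg := 1) (gmax := 1) zero_le_one (fun x => (omegaV_pos n M _ _ x).le)
    (omegaV_le_one n M _ _) (fun σ b hv i j _ hρ => ?_) p hp f
  have hi : tIdx i ≤ rho i j := le_max_left _ _
  have hj : tIdx j ≤ rho i j := le_max_right _ _
  have h8 : (2 : ℤ) ^ (J + 3) = 8 * 2 ^ J := by ring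
  have hP : ((2 ^ J : ℕ) : ℤ) = (2 : ℤ) ^ J := by push_cast; ring
  have hK : ((n - 1 : ℕ) : ℤ) = (n : ℤ) - 1 := by omega
  have h20 : (20 : ℤ) * 2 ^ J + 2 ≤ n := by rw [← hP]; omega
  have h := omegaV_emb_le n M (V := Vre M S) hv (K := n - 1) (i := i) (j := j) (by rw [hK]; nlinarith) (by rw [hK]; nlinarith)
  rw [one_mul]
  exact h

/-- **(Φ′): THE EXTERIOR SECOND-DIFFERENCE DENSITY OF THE FINE SOLUTION**: `Σ_μ Σ_{x∉Ω′}|(∂′ᴴ_μ∂′_μ v_w)(x)|² ≤ 4RN·X·‖w‖²`. [folklore] -/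
theorem binderE (hN : 64 ≤ N) (hM2 : ∀ ν, 2 ≤ M ν) (ha' : 0 < a') (hε : 0 < ε) (hγ : 1 < Real.pi / 3 * (1 - ε / 2))
    (w : {x // refineR N R M (blockReg N M S) x} → ℂ) :
    ∑ μ, ∑ x ∈ univ.filter (fun x => ¬ refineR N R M (blockReg N M S) x),
        ‖(Pdir (fine (R * N) M) ((R * N : ℕ) : ℂ) μ *ᵥ solExt (R * N) M a' (refineR N R M (blockReg N M S)) w) x‖ ^ 2
      ≤ 4 * ((R * N : ℕ) : ℝ) * Xflux (Vre M S).card (Fintype.card (Tor M)) ε a' * nsq w := by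
  have hR1 : 1 ≤ R := Nat.pos_of_ne_zero (NeZero.ne R)
  have hRN : 64 ≤ R * N := le_trans hN (Nat.le_mul_of_pos_left N hR1)
  set v := solExt (R * N) M a' (refineR N R M (blockReg N M S)) w with hv
  have hiff := refineR_blockReg_iff N R M S
  have hv0 : ∀ x, ¬ blockReg (R * N) M S x → v x = 0 := fun x hx => solExt_apply_of_not (R * N) M a' _ w (fun h => hx ((hiff x).mp h))
  have hfilt : univ.filter (fun x => ¬ refineR N R M (blockReg N M S) x) = univ.filter (fun x => ¬ blockReg (R * N) M S x) :=
    filter_congr fun x _ => not_congr (hiff x)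
  have hfilt' : univ.filter (blockReg (R * N) M S) = univ.filter (refineR N R M (blockReg N M S)) := filter_congr fun x _ => (hiff x).symm
  rw [hfilt]
  have h0 := exterior_sum_le M (Vre M S) S N R (by omega) hM2 hv0
  have hB := weighted_energy_solExt_le' (R * N) M S a' (Vre M S) (Vre_sound M S) (by omega) (hM2 0) (hM2 1) ha' hε hγ
    (refineR N R M (blockReg N M S)) hiff w
  have hA := hessian_omega_le M S a' (R * N) hRN hM2 ha' hε hγ (refineR N R M (blockReg N M S)) hiff w
  rw [← hfilt'] at hA
  rw [← hv] at hB hA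
  have hc : (0 : ℝ) ≤ 4 * ((R * N : ℕ) : ℝ) := by positivity
  have hV : (0 : ℝ) ≤ 1 + (Vre M S).card := by positivity
  refine h0.trans ?_
  rw [Xflux]
  nlinarith [mul_le_mul_of_nonneg_left hB (by norm_num : (0 : ℝ) ≤ 18), mul_le_mul_of_nonneg_left hA hV]

/-- **(Φ): THE BOUNDARY PART OF THE COARSE DIFFERENCES**: `Σ_μ nsq(bdryPart(∂_μ u_f)) ≤ (2X/N)·‖f‖²`. [folklore] -/
theorem binderT (hN : 64 ≤ N) (hM2 : ∀ ν, 2 ≤ M ν) (ha' : 0 < a') (hε : 0 < ε) (hγ : 1 < Real.pi / 3 * (1 - ε / 2))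
    (f : {y // blockReg N M S y} → ℂ) :
    ∑ μ, nsq (bdryPart N M (blockReg N M S) μ (sdiff (fine N M) (N : ℂ) μ *ᵥ solExt N M a' (blockReg N M S) f))
      ≤ 2 * Xflux (Vre M S).card (Fintype.card (Tor M)) ε a' / N * nsq f := by
  have hN0 : (0 : ℝ) < N := by exact_mod_cast Nat.pos_of_ne_zero (NeZero.ne N)
  set u := solExt N M a' (blockReg N M S) f with hu
  have hu0 : ∀ y, ¬ blockReg N M S y → u y = 0 := fun y hy => solExt_apply_of_not N M a' _ f hy
  have h0 := bdry_sum_le N M (Vre M S) S (by omega) hM2 hu0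
  have hB := binderB N M S a' (by omega) hM2 ha' hε hγ f
  have hA := hessian_omega_le M S a' N hN hM2 ha' hε hγ (blockReg N M S) (fun _ => Iff.rfl) f
  rw [← hu] at hB hA
  refine h0.trans ?_
  have hV : (0 : ℝ) ≤ 1 + (Vre M S).card := by positivity
  have e : 2 * Xflux (Vre M S).card (Fintype.card (Tor M)) ε a' / N * nsq f
      = 36 / (N : ℝ) * (betaV (Vre M S).card ε a' * nsq f)
        + 2 * (1 + (Vre M S).card) / (N : ℝ) * (alphaDom (Vre M S).card (Fintype.card (Tor M)) 1 1 ε a' * nsq f) := by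
    rw [Xflux]; field_simp; ring
  rw [e]
  exact add_le_add (mul_le_mul_of_nonneg_left hB (by positivity)) (mul_le_mul_of_nonneg_left hA (by positivity))

end Binders

/-! ## §2 THE END: the two-level injected law on every union of unit blocks in two dimensions -/

/-- nonnegativity of `β_V`. [folklore] -/
theorem betaV_nonneg (cardV : ℕ) {ε : ℝ} (hε : 0 < ε) (hγ : 1 < Real.pi / 3 * (1 - ε / 2)) : 0 ≤ betaV cardV ε a' := by
  have hγp := (gammaPs_pos (d := 2) (a' := a')).1
  have hπ3 := Real.pi_gt_three
  set γ := Real.pi / 3 * (1 - ε / 2) with hγdef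
  have hε2 : ε < 2 := by
    by_contra h
    have : Real.pi / 3 * (1 - ε / 2) ≤ 0 := mul_nonpos_of_nonneg_of_nonpos (by positivity) (by linarith)
    linarith
  have hγ1 : 0 < γ - 1 := by linarith
  have h2γ : 0 < 2 - γ := by
    have h1 : Real.pi / 3 * (1 - ε / 2) ≤ Real.pi / 3 * 1 := mul_le_mul_of_nonneg_left (by linarith) (by positivity)
    linarith [Real.pi_lt_four]
  unfold betaV; positivity

/-- nonnegativity of `α_dom` (`0 ≤ C_g`, `0 ≤ g_max`). [folklore] -/
theorem alphaDom_nonneg (cardV cardT : ℕ) {Cg gmax ε : ℝ} (hCg : 0 ≤ Cg) (hg : 0 ≤ gmax) (hε : 0 < ε)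
    (hγ : 1 < Real.pi / 3 * (1 - ε / 2)) : 0 ≤ alphaDom cardV cardT Cg gmax ε a' := by
  have hγp := (gammaPs_pos (d := 2) (a' := a')).1
  have hπ3 := Real.pi_gt_three
  set γ := Real.pi / 3 * (1 - ε / 2) with hγdef
  have hε2 : ε < 2 := by
    by_contra h
    have : Real.pi / 3 * (1 - ε / 2) ≤ 0 := mul_nonpos_of_nonneg_of_nonpos (by positivity) (by linarith)
    linarith
  have hγ1 : 0 < γ - 1 := by linarith
  have h2γ : 0 < 2 - γ := by
    have h1 : Real.pi / 3 * (1 - ε / 2) ≤ Real.pi / 3 * 1 := mul_le_mul_of_nonneg_left (by linarith) (by positivity)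
    linarith [Real.pi_lt_four]
  unfold alphaDom alphaV DirichletVertexDomSum.cU; positivity

/-- **THE END CONSTANT** `C = 2·(√(α_w·β_V) + √(8R)·X)`, `α_w = α_dom(|V|, |Tor M|, 3(1+2R), 3)`, `X = 18β_V + (1+|V|)α_dom(|V|, |Tor M|, 1, 1)`. [folklore] -/
def Cend (cardV cardT R : ℕ) (ε a' : ℝ) : ℝ :=
  2 * (Real.sqrt (alphaDom cardV cardT (3 * (1 + 2 * R)) 3 ε a' * betaV cardV ε a') + Real.sqrt (8 * R) * Xflux cardV cardT ε a')

/-- **THE TWO-LEVEL INJECTED LAW OF THE Ω-COMPRESSED `U = 1` SCALAR FREE TOWER ON EVERY UNION OF UNIT BLOCKS, `d = 2`** (socket form):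
for every set `S` of unit blocks of `Tor (fine N M)` (`M_ν ≥ 2`, `N ≥ 64`), `Ω = blockReg N M S`, `Ω′ = par⁻¹Ω`, `a′ > 0`, `0 < ε`,
`1 < π/3·(1−ε/2)`:
`‖(D′^{Ω′})⁻¹·J^Ω − J^Ω·(D^Ω)⁻¹‖ ≤ (2/N)·(√α_w·√β_V + √(4RN·X)·√(2X/N))`. [folklore] -/
theorem injected_le_union (hN : 64 ≤ N) (hM2 : ∀ ν, 2 ≤ M ν) {a' : ℝ} (ha' : 0 < a') {ε : ℝ} (hε : 0 < ε)
    (hγ : 1 < Real.pi / 3 * (1 - ε / 2)) :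
    ‖(DOm (R * N) M a' (refineR N R M (blockReg N M S)))⁻¹ * JOm N R M (blockReg N M S)
        - JOm N R M (blockReg N M S) * (DOm N M a' (blockReg N M S))⁻¹‖
      ≤ 2 / (N : ℝ) * (Real.sqrt (alphaDom (Vre M S).card (Fintype.card (Tor M)) (3 * (1 + 2 * R)) 3 ε a')
          * Real.sqrt (betaV (Vre M S).card ε a')
        + Real.sqrt (4 * ((R * N : ℕ) : ℝ) * Xflux (Vre M S).card (Fintype.card (Tor M)) ε a')
          * Real.sqrt (2 * Xflux (Vre M S).card (Fintype.card (Tor M)) ε a' / N)) := by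
  have hN0 : (0 : ℝ) < N := by exact_mod_cast Nat.pos_of_ne_zero (NeZero.ne N)
  have hβ := betaV_nonneg a' (Vre M S).card hε hγ
  have hαw := alphaDom_nonneg a' (Vre M S).card (Fintype.card (Tor M)) (Cg := 3 * (1 + 2 * R)) (gmax := 3) (by positivity)
    (by norm_num) hε hγ
  have hα1 := alphaDom_nonneg a' (Vre M S).card (Fintype.card (Tor M)) (Cg := 1) (gmax := 1) zero_le_one zero_le_one hε hγ
  have hX : 0 ≤ Xflux (Vre M S).card (Fintype.card (Tor M)) ε a' := by unfold Xflux; positivity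
  exact injected_le_of_weighted N R M (blockReg N M S) a' (by omega) ha' (ω := omegaV N M (Vre M S) (N - 1))
    (w' := wfine N R M (Vre M S) (N - 1)) (omegaV_pos N M _ _) (wfine_nonneg N R M _ _) (wfine_hcomp N R M (Vre M S) (N - 1))
    hαw hβ (by positivity) (by positivity)
    (binderA N R M S a' hN hM2 ha' hε hγ) (binderB N M S a' (by omega) hM2 ha' hε hγ)
    (binderE N R M S a' hN hM2 ha' hε hγ) (binderT N M S a' hN hM2 ha' hε hγ)

/-- **THE FULL RATE `1/N` ON EVERY UNION OF UNIT BLOCKS IN TWO DIMENSIONS**: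
`‖(D′^{Ω′})⁻¹·J^Ω − J^Ω·(D^Ω)⁻¹‖ ≤ C(a′, ε, |V|, |Tor M|, R) / N` with `C = Cend`, for every `S`, `M_ν ≥ 2`, `N ≥ 64`. [folklore] -/
theorem injected_rate_union (hN : 64 ≤ N) (hM2 : ∀ ν, 2 ≤ M ν) {a' : ℝ} (ha' : 0 < a') {ε : ℝ} (hε : 0 < ε)
    (hγ : 1 < Real.pi / 3 * (1 - ε / 2)) :
    ‖(DOm (R * N) M a' (refineR N R M (blockReg N M S)))⁻¹ * JOm N R M (blockReg N M S)
        - JOm N R M (blockReg N M S) * (DOm N M a' (blockReg N M S))⁻¹‖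
      ≤ Cend (Vre M S).card (Fintype.card (Tor M)) R ε a' / N := by
  have hN0 : (0 : ℝ) < N := by exact_mod_cast Nat.pos_of_ne_zero (NeZero.ne N)
  have hR0 : (0 : ℝ) ≤ R := Nat.cast_nonneg _
  have hβ := betaV_nonneg a' (Vre M S).card hε hγ
  have hαw := alphaDom_nonneg a' (Vre M S).card (Fintype.card (Tor M)) (Cg := 3 * (1 + 2 * R)) (gmax := 3) (by positivity)
    (by norm_num) hε hγ
  have hα1 := alphaDom_nonneg a' (Vre M S).card (Fintype.card (Tor M)) (Cg := 1) (gmax := 1) zero_le_one zero_le_one hε hγ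
  have hX : 0 ≤ Xflux (Vre M S).card (Fintype.card (Tor M)) ε a' := by unfold Xflux; positivity
  refine (injected_le_union N R M S hN hM2 ha' hε hγ).trans (le_of_eq ?_)
  set X := Xflux (Vre M S).card (Fintype.card (Tor M)) ε a' with hXdef
  have e1 : Real.sqrt (4 * ((R * N : ℕ) : ℝ) * X) * Real.sqrt (2 * X / N) = Real.sqrt (8 * R) * X := by
    rw [← Real.sqrt_mul (by positivity)]
    have e : 4 * ((R * N : ℕ) : ℝ) * X * (2 * X / N) = (8 * R) * (X * X) := by push_cast; field_simp; ring
    rw [e, Real.sqrt_mul (by positivity), Real.sqrt_mul_self hX]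
  have e2 : Real.sqrt (alphaDom (Vre M S).card (Fintype.card (Tor M)) (3 * (1 + 2 * R)) 3 ε a') * Real.sqrt (betaV (Vre M S).card ε a')
      = Real.sqrt (alphaDom (Vre M S).card (Fintype.card (Tor M)) (3 * (1 + 2 * R)) 3 ε a' * betaV (Vre M S).card ε a') :=
    (Real.sqrt_mul hαw _).symm
  rw [e1, e2, Cend, hXdef]
  field_simp

end Summit.QuantumFields.BalabanUV.Beta.GAN24.DirichletVertexEnd

end
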